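import Summits.CriticalPhenomena.SAWScalingLimit.Theorems.SAWLoopFugacityFlowIsingBoundaryRatioRadialDefs
import Literature.Probability.LatticeModels.FKIsingAnnulusCrossingRSW
import HarnessLib

/-!
# Gluing open box crossings along a chain of lattice squares
(line `fk-anchor-transfer`, crux `IsingBoundaryRatio`, stmt-CriticalPhenomena-10650; helper file of the stub
`stub_halfAnnulusRadialCrossingBound`, RSW clause (iii))

The deterministic, purely lattice part of the bulk RSW chain behind the radial crossing lower bound: for a
lattice configuration `ω ⊆ E(ℤ²)` and a chain of lattice squares `v k + [0, s]²`, `k ≤ L`, consecutive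
squares being equal or side-adjacent, if every square has an open left-right and an open top-bottom
crossing and every domino formed by two consecutive distinct squares is crossed the long way by an open
path, then some site of the first square is joined to some site of the last square by an open path inside
the union of the squares (`exists_openConnIn_of_squareChain`). Ingredients: the first/last visit of an open
path to a coordinate line (`exists_openConnIn_coord_le/ge`, the two-coordinate form of the tree's
`exists_openConnIn_column(_ge)`), and the planar meeting of a left-right and a top-bottom crossing of a box
(the tree's `exists_mem_support_of_crossing`, `PlanarDuality.lean`). [folklore]
-/

noncomputable section

open scoped Classical
open Set SimpleGraph
open Literature.Probability.LatticeModels Literature.Probability.Percolation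

namespace Summit.CriticalPhenomena.SAWScalingLimit.Theorems.IsingBoundaryRatio

namespace RadialChain

/-! ### Boxes and their open crossings -/

/-- The lattice box `v + [0, a] × [0, b]`, as a set of sites. [folklore] -/
def boxSet (v : Site 2) (a b : ℕ) : Set (Site 2) :=
  {z | v 0 ≤ z 0 ∧ z 0 ≤ v 0 + a ∧ v 1 ≤ z 1 ∧ z 1 ≤ v 1 + b}

/-- Membership in `boxSet`, unfolded. [folklore] -/
theorem mem_boxSet {v z : Site 2} {a b : ℕ} :
    z ∈ boxSet v a b ↔ v 0 ≤ z 0 ∧ z 0 ≤ v 0 + a ∧ v 1 ≤ z 1 ∧ z 1 ≤ v 1 + b := Iff.rfl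

/-- **Open left-right crossing** of the box `v + [0, a] × [0, b]` from `x` (left column) to `z` (right
column), inside the box (an event). [folklore] -/
def crossLR (v : Site 2) (a b : ℕ) (x z : Site 2) : Set (BondConfig (Site 2)) :=
  {ω | x 0 = v 0 ∧ z 0 = v 0 + a ∧ ω ∈ openConnIn (boxSet v a b) x z}

/-- Membership in `crossLR`, unfolded. [folklore] -/
@[simp] theorem mem_crossLR {v : Site 2} {a b : ℕ} {x z : Site 2} {ω : BondConfig (Site 2)} :
    ω ∈ crossLR v a b x z ↔ x 0 = v 0 ∧ z 0 = v 0 + a ∧ ω ∈ openConnIn (boxSet v a b) x z := Iff.rfl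

/-- **Open top-bottom crossing** of the box `v + [0, a] × [0, b]` from `x` (bottom row) to `z` (top row),
inside the box (an event). [folklore] -/
def crossTB (v : Site 2) (a b : ℕ) (x z : Site 2) : Set (BondConfig (Site 2)) :=
  {ω | x 1 = v 1 ∧ z 1 = v 1 + b ∧ ω ∈ openConnIn (boxSet v a b) x z}

/-- Membership in `crossTB`, unfolded. [folklore] -/
@[simp] theorem mem_crossTB {v : Site 2} {a b : ℕ} {x z : Site 2} {ω : BondConfig (Site 2)} :
    ω ∈ crossTB v a b x z ↔ x 1 = v 1 ∧ z 1 = v 1 + b ∧ ω ∈ openConnIn (boxSet v a b) x z := Iff.rfl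

/-! ### First and last visits to a coordinate line -/

/-- First visit to the line `{z i = a}`: an open lattice path inside `S` from `x` with `x i ≤ a` to `y` with
`a ≤ y i` contains an initial piece inside `S ∩ {z i ≤ a}` ending on the line. [folklore] -/
theorem exists_openConnIn_coord_le {ω : BondConfig (Site 2)} (hω : ω ⊆ (zdGraph 2).edgeSet) (i : Fin 2)
    {S : Set (Site 2)} {x y : Site 2} (a : ℤ) (hx : x i ≤ a) (hy : a ≤ y i)
    (h : ω ∈ openConnIn S x y) :
    ∃ z, z i = a ∧ ω ∈ openConnIn (S ∩ {z | z i ≤ a}) x z := by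
  obtain ⟨hxS, hyS, ⟨p⟩⟩ := h
  suffices H : ∀ (u v : S) (_ : ((openGraph ω).induce S).Walk u v), (u : Site 2) i ≤ a →
      a ≤ (v : Site 2) i → ∃ z, z i = a ∧ ω ∈ openConnIn (S ∩ {z | z i ≤ a}) u z from
    H ⟨x, hxS⟩ ⟨y, hyS⟩ p hx hy
  intro u v p
  induction p with
  | nil =>
    intro hu hv
    rename_i u
    exact ⟨u, le_antisymm hu hv, ⟨u.2, hu⟩, ⟨u.2, hu⟩, Reachable.refl _⟩
  | cons hadj p ih =>
    intro hu hv
    rename_i u w v'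
    rcases hu.eq_or_lt with hua | hua
    · exact ⟨u, hua, ⟨u.2, hu⟩, ⟨u.2, hu⟩, Reachable.refl _⟩
    · have hadj' : (openGraph ω).Adj u w := hadj
      have hw : (w : Site 2) i ≤ a := by
        have hzd : (zdGraph 2).Adj (u : Site 2) (w : Site 2) := hω ((openGraph_adj _ _ _).1 hadj').1
        have := (zdGraph_adj_apply_le hzd i).1
        omega
      obtain ⟨z, hz, huS, hzS, hr⟩ := ih hw hv
      refine ⟨z, hz, ⟨u.2, hu⟩, hzS, ?_⟩
      refine Reachable.trans (Adj.reachable ?_) hr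
      simpa [induce_adj] using hadj'

/-- Mirror image: an open lattice path inside `S` from `x` with `a ≤ x i` to `y` with `y i ≤ a` contains an
initial piece inside `S ∩ {a ≤ z i}` ending on the line `{z i = a}`. [folklore] -/
theorem exists_openConnIn_coord_ge {ω : BondConfig (Site 2)} (hω : ω ⊆ (zdGraph 2).edgeSet) (i : Fin 2)
    {S : Set (Site 2)} {x y : Site 2} (a : ℤ) (hx : a ≤ x i) (hy : y i ≤ a)
    (h : ω ∈ openConnIn S x y) :
    ∃ z, z i = a ∧ ω ∈ openConnIn (S ∩ {z | a ≤ z i}) x z := by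
  obtain ⟨hxS, hyS, ⟨p⟩⟩ := h
  suffices H : ∀ (u v : S) (_ : ((openGraph ω).induce S).Walk u v), a ≤ (u : Site 2) i →
      (v : Site 2) i ≤ a → ∃ z, z i = a ∧ ω ∈ openConnIn (S ∩ {z | a ≤ z i}) u z from
    H ⟨x, hxS⟩ ⟨y, hyS⟩ p hx hy
  intro u v p
  induction p with
  | nil =>
    intro hu hv
    rename_i u
    exact ⟨u, le_antisymm hv hu, ⟨u.2, hu⟩, ⟨u.2, hu⟩, Reachable.refl _⟩
  | cons hadj p ih =>
    intro hu hv
    rename_i u w v'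
    rcases hu.eq_or_lt with hua | hua
    · exact ⟨u, hua.symm, ⟨u.2, hu⟩, ⟨u.2, hu⟩, Reachable.refl _⟩
    · have hadj' : (openGraph ω).Adj u w := hadj
      have hw : a ≤ (w : Site 2) i := by
        have hzd : (zdGraph 2).Adj (u : Site 2) (w : Site 2) := hω ((openGraph_adj _ _ _).1 hadj').1
        have := (zdGraph_adj_apply_le hzd i).2
        omega
      obtain ⟨z, hz, huS, hzS, hr⟩ := ih hw hv
      refine ⟨z, hz, ⟨u.2, hu⟩, hzS, ?_⟩
      refine Reachable.trans (Adj.reachable ?_) hr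
      simpa [induce_adj] using hadj'

/-! ### A left-right and a top-bottom crossing of a box meet -/

/-- **A left-right and a top-bottom open crossing of the same box are joined inside the box** (they
share a vertex, `exists_mem_support_of_crossing`). [folklore] -/
theorem openConnIn_of_crossLR_crossTB {ω : BondConfig (Site 2)} (hω : ω ⊆ (zdGraph 2).edgeSet)
    {v : Site 2} {a b : ℕ} {x z c d : Site 2} (h₁ : ω ∈ crossLR v a b x z) (h₂ : ω ∈ crossTB v a b c d) :
    ω ∈ openConnIn (boxSet v a b) x c := by
  obtain ⟨hx, hz, hxz⟩ := h₁
  obtain ⟨hc, hd, hcd⟩ := h₂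
  obtain ⟨P, hPS, hPω⟩ := exists_walk_of_mem_openConnIn hω hxz
  obtain ⟨Q, hQS, hQω⟩ := exists_walk_of_mem_openConnIn hω hcd
  obtain ⟨w, hwP, hwQ⟩ := exists_mem_support_of_crossing (L := v 0) (R := v 0 + a) (B := v 1)
    (T := v 1 + b) P Q (fun w hw => hPS w hw) (fun w hw => hQS w hw) hx hz hc hd
  exact PlanarDuality.openConnIn_trans (mem_openConnIn_of_mem_support P hPS hPω hwP)
    (((Literature.Probability.Percolation.openConnIn_comm _ _ _).le (mem_openConnIn_of_mem_support Q hQS hQω hwQ)))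

/-- **Spreading inside a box.** If `x₀` is joined inside `R ⊇ box` to the left end of some open left-right
crossing of the box, and the box has an open top-bottom crossing, then `x₀` is joined inside `R` to both
ends of every open left-right crossing and of every open top-bottom crossing of the box. [folklore] -/
theorem spread {ω : BondConfig (Site 2)} (hω : ω ⊆ (zdGraph 2).edgeSet) {v : Site 2} {a b : ℕ}
    {R : Set (Site 2)} (hR : boxSet v a b ⊆ R) {x₀ p q : Site 2} (hpq : ω ∈ crossLR v a b p q)
    (hp : ω ∈ openConnIn R x₀ p) (hTB : ∃ c d, ω ∈ crossTB v a b c d) :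
    (∀ x z, ω ∈ crossLR v a b x z → ω ∈ openConnIn R x₀ x ∧ ω ∈ openConnIn R x₀ z) ∧
    (∀ c d, ω ∈ crossTB v a b c d → ω ∈ openConnIn R x₀ c ∧ ω ∈ openConnIn R x₀ d) := by
  have key : ∀ c d, ω ∈ crossTB v a b c d → ω ∈ openConnIn R x₀ c ∧ ω ∈ openConnIn R x₀ d := by
    intro c d hcd
    have h1 : ω ∈ openConnIn R x₀ c :=
      PlanarDuality.openConnIn_trans hp (openConnIn_mono hR _ _ (openConnIn_of_crossLR_crossTB hω hpq hcd))
    exact ⟨h1, PlanarDuality.openConnIn_trans h1 (openConnIn_mono hR _ _ hcd.2.2)⟩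
  refine ⟨fun x z hxz => ?_, key⟩
  obtain ⟨c, d, hcd⟩ := hTB
  have h1 : ω ∈ openConnIn R x₀ x :=
    PlanarDuality.openConnIn_trans (key c d hcd).1
      (openConnIn_mono hR _ _ (((Literature.Probability.Percolation.openConnIn_comm _ _ _).le (openConnIn_of_crossLR_crossTB hω hxz hcd))))
  exact ⟨h1, PlanarDuality.openConnIn_trans h1 (openConnIn_mono hR _ _ hxz.2.2)⟩

/-! ### Dominoes: two side-adjacent squares crossed the long way -/

/-- The left half of the horizontal domino `u + [0, 2s] × [0, s]` is the square `u + [0, s]²`. [folklore] -/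
theorem boxSet_inter_le (u : Site 2) (s : ℕ) :
    boxSet u (2 * s) s ∩ {z | z 0 ≤ u 0 + s} = boxSet u s s := by
  ext z; simp only [mem_inter_iff, mem_boxSet, mem_setOf_eq]; push_cast; omega

/-- The right half of the horizontal domino is the square `(u + (s, 0)) + [0, s]²`. [folklore] -/
theorem boxSet_inter_ge (u : Site 2) (s : ℕ) :
    boxSet u (2 * s) s ∩ {z | u 0 + s ≤ z 0} = boxSet (u + ![(s : ℤ), 0]) s s := by
  ext z
  simp only [mem_inter_iff, mem_boxSet, mem_setOf_eq, Pi.add_apply, Matrix.cons_val_zero,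
    Matrix.cons_val_one]
  push_cast; omega

/-- The bottom half of the vertical domino `u + [0, s] × [0, 2s]` is the square `u + [0, s]²`. [folklore] -/
theorem boxSet_inter_le' (u : Site 2) (s : ℕ) :
    boxSet u s (2 * s) ∩ {z | z 1 ≤ u 1 + s} = boxSet u s s := by
  ext z; simp only [mem_inter_iff, mem_boxSet, mem_setOf_eq]; push_cast; omega

/-- The top half of the vertical domino is the square `(u + (0, s)) + [0, s]²`. [folklore] -/
theorem boxSet_inter_ge' (u : Site 2) (s : ℕ) :
    boxSet u s (2 * s) ∩ {z | u 1 + s ≤ z 1} = boxSet (u + ![(0 : ℤ), s]) s s := by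
  ext z
  simp only [mem_inter_iff, mem_boxSet, mem_setOf_eq, Pi.add_apply, Matrix.cons_val_zero,
    Matrix.cons_val_one]
  push_cast; omega

/-- **Horizontal domino.** An open left-right crossing of `u + [0, 2s] × [0, s]` contains an open
left-right crossing `x → z` of the left square, an open left-right crossing `z' → y` of the right square,
and joins `z` to `z'` inside the domino. [folklore] -/
theorem domino_horizontal {ω : BondConfig (Site 2)} (hω : ω ⊆ (zdGraph 2).edgeSet) {u : Site 2} {s : ℕ}
    {x y : Site 2} (h : ω ∈ crossLR u (2 * s) s x y) :
    ∃ z z', ω ∈ crossLR u s s x z ∧ ω ∈ crossLR (u + ![(s : ℤ), 0]) s s z' y ∧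
      ω ∈ openConnIn (boxSet u (2 * s) s) z z' := by
  obtain ⟨hx, hy, hxy⟩ := h
  obtain ⟨z, hz, hxz⟩ := exists_openConnIn_coord_le hω 0 (u 0 + s) (by rw [hx]; omega)
    (by rw [hy]; push_cast; omega) hxy
  obtain ⟨z', hz', hyz'⟩ := exists_openConnIn_coord_ge hω 0 (u 0 + s) (by rw [hy]; push_cast; omega)
    (by rw [hx]; omega) (((Literature.Probability.Percolation.openConnIn_comm _ _ _).le hxy))
  rw [boxSet_inter_le] at hxz
  rw [boxSet_inter_ge] at hyz'
  refine ⟨z, z', ⟨hx, by rw [hz], hxz⟩, ⟨?_, ?_, ((Literature.Probability.Percolation.openConnIn_comm _ _ _).le hyz')⟩, ?_⟩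
  · simp only [Pi.add_apply, Matrix.cons_val_zero]; rw [hz']
  · simp only [Pi.add_apply, Matrix.cons_val_zero]; rw [hy]; push_cast; ring
  · have h1 : ω ∈ openConnIn (boxSet u (2 * s) s) z x := by
      refine ((Literature.Probability.Percolation.openConnIn_comm _ _ _).le (openConnIn_mono (fun w hw => ?_) _ _ hxz))
      rw [← boxSet_inter_le] at hw; exact hw.1
    have h2 : ω ∈ openConnIn (boxSet u (2 * s) s) y z' := by
      refine openConnIn_mono (fun w hw => ?_) _ _ hyz'
      rw [← boxSet_inter_ge] at hw; exact hw.1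
    exact PlanarDuality.openConnIn_trans (PlanarDuality.openConnIn_trans h1 hxy) h2

/-- **Vertical domino.** An open top-bottom crossing of `u + [0, s] × [0, 2s]` contains an open
top-bottom crossing `x → z` of the bottom square, an open top-bottom crossing `z' → y` of the top square,
and joins `z` to `z'` inside the domino. [folklore] -/
theorem domino_vertical {ω : BondConfig (Site 2)} (hω : ω ⊆ (zdGraph 2).edgeSet) {u : Site 2} {s : ℕ}
    {x y : Site 2} (h : ω ∈ crossTB u s (2 * s) x y) :
    ∃ z z', ω ∈ crossTB u s s x z ∧ ω ∈ crossTB (u + ![(0 : ℤ), s]) s s z' y ∧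
      ω ∈ openConnIn (boxSet u s (2 * s)) z z' := by
  obtain ⟨hx, hy, hxy⟩ := h
  obtain ⟨z, hz, hxz⟩ := exists_openConnIn_coord_le hω 1 (u 1 + s) (by rw [hx]; omega)
    (by rw [hy]; push_cast; omega) hxy
  obtain ⟨z', hz', hyz'⟩ := exists_openConnIn_coord_ge hω 1 (u 1 + s) (by rw [hy]; push_cast; omega)
    (by rw [hx]; omega) (((Literature.Probability.Percolation.openConnIn_comm _ _ _).le hxy))
  rw [boxSet_inter_le'] at hxz
  rw [boxSet_inter_ge'] at hyz'
  refine ⟨z, z', ⟨hx, by rw [hz], hxz⟩, ⟨?_, ?_, ((Literature.Probability.Percolation.openConnIn_comm _ _ _).le hyz')⟩, ?_⟩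
  · simp only [Pi.add_apply, Matrix.cons_val_one, Matrix.cons_val_fin_one]; rw [hz']
  · simp only [Pi.add_apply, Matrix.cons_val_one, Matrix.cons_val_fin_one]; rw [hy]; push_cast; ring
  · have h1 : ω ∈ openConnIn (boxSet u s (2 * s)) z x := by
      refine ((Literature.Probability.Percolation.openConnIn_comm _ _ _).le (openConnIn_mono (fun w hw => ?_) _ _ hxz))
      rw [← boxSet_inter_le'] at hw; exact hw.1
    have h2 : ω ∈ openConnIn (boxSet u s (2 * s)) y z' := by
      refine openConnIn_mono (fun w hw => ?_) _ _ hyz'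
      rw [← boxSet_inter_ge'] at hw; exact hw.1
    exact PlanarDuality.openConnIn_trans (PlanarDuality.openConnIn_trans h1 hxy) h2

/-! ### The chain of squares -/

/-- The union of the squares `v k + [0, s]²`, `k ≤ i`. [folklore] -/
def chainRegion (v : ℕ → Site 2) (s : ℕ) (i : ℕ) : Set (Site 2) := {z | ∃ k ≤ i, z ∈ boxSet (v k) s s}

/-- The squares of the chain lie in the region. [folklore] -/
theorem boxSet_subset_chainRegion (v : ℕ → Site 2) (s : ℕ) {k i : ℕ} (hk : k ≤ i) :
    boxSet (v k) s s ⊆ chainRegion v s i := fun _ hz => ⟨k, hk, hz⟩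

/-- The region grows along the chain. [folklore] -/
theorem chainRegion_mono (v : ℕ → Site 2) (s : ℕ) {i i' : ℕ} (h : i ≤ i') :
    chainRegion v s i ⊆ chainRegion v s i' := fun _ ⟨k, hk, hz⟩ => ⟨k, hk.trans h, hz⟩

/-- A horizontal domino on two consecutive squares of the chain lies in the region. [folklore] -/
theorem boxSet_domino_subset {v : ℕ → Site 2} {s i k k' : ℕ} (hk : k ≤ i) (hk' : k' ≤ i)
    (h : v k' = v k + ![(s : ℤ), 0]) : boxSet (v k) (2 * s) s ⊆ chainRegion v s i := by
  intro z hz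
  by_cases hz0 : z 0 ≤ v k 0 + s
  · exact ⟨k, hk, by rw [← boxSet_inter_le]; exact ⟨hz, hz0⟩⟩
  · refine ⟨k', hk', ?_⟩
    rw [h, ← boxSet_inter_ge]
    exact ⟨hz, by simp only [mem_setOf_eq]; omega⟩

/-- A vertical domino on two consecutive squares of the chain lies in the region. [folklore] -/
theorem boxSet_domino_subset' {v : ℕ → Site 2} {s i k k' : ℕ} (hk : k ≤ i) (hk' : k' ≤ i)
    (h : v k' = v k + ![(0 : ℤ), s]) : boxSet (v k) s (2 * s) ⊆ chainRegion v s i := by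
  intro z hz
  by_cases hz1 : z 1 ≤ v k 1 + s
  · exact ⟨k, hk, by rw [← boxSet_inter_le']; exact ⟨hz, hz1⟩⟩
  · refine ⟨k', hk', ?_⟩
    rw [h, ← boxSet_inter_ge']
    exact ⟨hz, by simp only [mem_setOf_eq]; omega⟩

/-- **Gluing open crossings along a chain of squares** (the deterministic part of the RSW/FKG chaining;
Grimmett 1999 §11.7, Bollobás–Riordan 2006 Ch. 3, Fig. 8–9, here with squares and dominoes). Let
`v 0, …, v L` be lower-left corners of lattice squares of side `s`, consecutive corners equal or differing by
`(±s, 0)` or `(0, ±s)`. On a lattice configuration in which every square has an open left-right and an open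
top-bottom crossing and every domino formed by two consecutive distinct squares has an open crossing in its
long direction, some site of the first square is joined to some site of the last square by an open path
inside the union of the squares. [folklore] -/
theorem exists_openConnIn_of_squareChain {ω : BondConfig (Site 2)} (hω : ω ⊆ (zdGraph 2).edgeSet)
    (s : ℕ) (v : ℕ → Site 2) (L : ℕ)
    (hstep : ∀ i < L, v (i + 1) = v i ∨ v (i + 1) = v i + ![(s : ℤ), 0] ∨ v i = v (i + 1) + ![(s : ℤ), 0] ∨
      v (i + 1) = v i + ![(0 : ℤ), s] ∨ v i = v (i + 1) + ![(0 : ℤ), s])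
    (hLR : ∀ i ≤ L, ∃ x z, ω ∈ crossLR (v i) s s x z) (hTB : ∀ i ≤ L, ∃ x z, ω ∈ crossTB (v i) s s x z)
    (hH : ∀ i < L, ∀ k k', (k = i ∧ k' = i + 1 ∨ k = i + 1 ∧ k' = i) → v k' = v k + ![(s : ℤ), 0] →
      ∃ x z, ω ∈ crossLR (v k) (2 * s) s x z)
    (hV : ∀ i < L, ∀ k k', (k = i ∧ k' = i + 1 ∨ k = i + 1 ∧ k' = i) → v k' = v k + ![(0 : ℤ), s] →
      ∃ x z, ω ∈ crossTB (v k) s (2 * s) x z) :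
    ∃ x₀ ∈ boxSet (v 0) s s, ∃ y ∈ boxSet (v L) s s, ω ∈ openConnIn (chainRegion v s L) x₀ y := by
  -- invariant: `x₀` is joined inside the region to the left end of an open left-right crossing of the
  -- current square
  suffices H : ∀ i ≤ L, ∃ x₀ ∈ boxSet (v 0) s s, ∃ p q, ω ∈ crossLR (v i) s s p q ∧
      ω ∈ openConnIn (chainRegion v s i) x₀ p by
    obtain ⟨x₀, hx₀, p, q, hpq, hp⟩ := H L le_rfl
    exact ⟨x₀, hx₀, p, hpq.2.2.1, hp⟩
  intro i
  induction i with
  | zero =>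
    intro _
    obtain ⟨p, q, hpq⟩ := hLR 0 (Nat.zero_le _)
    exact ⟨p, hpq.2.2.1, p, q, hpq, openConnIn_refl ⟨0, le_rfl, hpq.2.2.1⟩⟩
  | succ i ih =>
    intro hi
    have hiL : i < L := Nat.lt_of_succ_le hi
    obtain ⟨x₀, hx₀, p, q, hpq, hp⟩ := ih hiL.le
    have hRi : boxSet (v i) s s ⊆ chainRegion v s i := boxSet_subset_chainRegion v s le_rfl
    have hsp := spread hω hRi hpq hp (hTB i hiL.le)
    have hmono : chainRegion v s i ⊆ chainRegion v s (i + 1) := chainRegion_mono v s (Nat.le_succ i)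
    have hR' : boxSet (v (i + 1)) s s ⊆ chainRegion v s (i + 1) := boxSet_subset_chainRegion v s le_rfl
    refine ⟨x₀, hx₀, ?_⟩
    rcases hstep i hiL with h | h | h | h | h
    · -- same square
      refine ⟨p, q, ?_, openConnIn_mono hmono _ _ hp⟩
      rw [h]; exact hpq
    · -- step to the right: domino at `v i`
      obtain ⟨x, y, hxy⟩ := hH i hiL i (i + 1) (Or.inl ⟨rfl, rfl⟩) h
      obtain ⟨z, z', hxz, hz'y, hzz'⟩ := domino_horizontal hω hxy
      rw [← h] at hz'y
      have h1 : ω ∈ openConnIn (chainRegion v s (i + 1)) x₀ z := openConnIn_mono hmono _ _ (hsp.1 x z hxz).2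
      have h2 : ω ∈ openConnIn (chainRegion v s (i + 1)) z z' :=
        openConnIn_mono (boxSet_domino_subset (Nat.le_succ i) le_rfl h) _ _ hzz'
      exact ⟨z', y, hz'y, PlanarDuality.openConnIn_trans h1 h2⟩
    · -- step to the left: domino at `v (i + 1)`
      obtain ⟨x, y, hxy⟩ := hH i hiL (i + 1) i (Or.inr ⟨rfl, rfl⟩) h
      obtain ⟨z, z', hxz, hz'y, hzz'⟩ := domino_horizontal hω hxy
      rw [← h] at hz'y
      have h1 : ω ∈ openConnIn (chainRegion v s (i + 1)) x₀ z' := openConnIn_mono hmono _ _ (hsp.1 z' y hz'y).1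
      have h2 : ω ∈ openConnIn (chainRegion v s (i + 1)) z' z :=
        ((Literature.Probability.Percolation.openConnIn_comm _ _ _).le (openConnIn_mono (boxSet_domino_subset le_rfl (Nat.le_succ i) h) _ _ hzz'))
      have h3 : ω ∈ openConnIn (chainRegion v s (i + 1)) z x :=
        ((Literature.Probability.Percolation.openConnIn_comm _ _ _).le (openConnIn_mono hR' _ _ hxz.2.2))
      exact ⟨x, z, hxz, PlanarDuality.openConnIn_trans (PlanarDuality.openConnIn_trans h1 h2) h3⟩
    · -- step up: vertical domino at `v i`
      obtain ⟨x, y, hxy⟩ := hV i hiL i (i + 1) (Or.inl ⟨rfl, rfl⟩) h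
      obtain ⟨z, z', hxz, hz'y, hzz'⟩ := domino_vertical hω hxy
      rw [← h] at hz'y
      have h1 : ω ∈ openConnIn (chainRegion v s (i + 1)) x₀ z := openConnIn_mono hmono _ _ (hsp.2 x z hxz).2
      have h2 : ω ∈ openConnIn (chainRegion v s (i + 1)) z z' :=
        openConnIn_mono (boxSet_domino_subset' (Nat.le_succ i) le_rfl h) _ _ hzz'
      obtain ⟨x₁, z₁, hx₁z₁⟩ := hLR (i + 1) hi
      have h3 : ω ∈ openConnIn (chainRegion v s (i + 1)) z' x₁ :=
        openConnIn_mono hR' _ _ (((Literature.Probability.Percolation.openConnIn_comm _ _ _).le (openConnIn_of_crossLR_crossTB hω hx₁z₁ hz'y)))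
      exact ⟨x₁, z₁, hx₁z₁, PlanarDuality.openConnIn_trans (PlanarDuality.openConnIn_trans h1 h2) h3⟩
    · -- step down: vertical domino at `v (i + 1)`
      obtain ⟨x, y, hxy⟩ := hV i hiL (i + 1) i (Or.inr ⟨rfl, rfl⟩) h
      obtain ⟨z, z', hxz, hz'y, hzz'⟩ := domino_vertical hω hxy
      rw [← h] at hz'y
      have h1 : ω ∈ openConnIn (chainRegion v s (i + 1)) x₀ z' := openConnIn_mono hmono _ _ (hsp.2 z' y hz'y).1
      have h2 : ω ∈ openConnIn (chainRegion v s (i + 1)) z' z :=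
        ((Literature.Probability.Percolation.openConnIn_comm _ _ _).le (openConnIn_mono (boxSet_domino_subset' le_rfl (Nat.le_succ i) h) _ _ hzz'))
      have h3 : ω ∈ openConnIn (chainRegion v s (i + 1)) z x :=
        ((Literature.Probability.Percolation.openConnIn_comm _ _ _).le (openConnIn_mono hR' _ _ hxz.2.2))
      obtain ⟨x₁, z₁, hx₁z₁⟩ := hLR (i + 1) hi
      have h4 : ω ∈ openConnIn (chainRegion v s (i + 1)) x x₁ :=
        openConnIn_mono hR' _ _ (((Literature.Probability.Percolation.openConnIn_comm _ _ _).le (openConnIn_of_crossLR_crossTB hω hx₁z₁ hxz)))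
      exact ⟨x₁, z₁, hx₁z₁, PlanarDuality.openConnIn_trans
        (PlanarDuality.openConnIn_trans (PlanarDuality.openConnIn_trans h1 h2) h3) h4⟩

end RadialChain

/-- **Gluing open crossings along a chain of lattice squares** (registered sub-goal of stmt-CriticalPhenomena-10650,
clause (iii) helper; closed form of `RadialChain.exists_openConnIn_of_squareChain`). [folklore] -/
theorem radial_squareChain : ∀ {ω : BondConfig (Site 2)}, ω ⊆ (zdGraph 2).edgeSet → ∀ (s : ℕ) (v : ℕ → Site 2) (L : ℕ), (∀ i < L, v (i + 1) = v i ∨ v (i + 1) = v i + ![(s : ℤ), 0] ∨ v i = v (i + 1) + ![(s : ℤ), 0] ∨ v (i + 1) = v i + ![(0 : ℤ), s] ∨ v i = v (i + 1) + ![(0 : ℤ), s]) → (∀ i ≤ L, ∃ x z, ω ∈ RadialChain.crossLR (v i) s s x z) → (∀ i ≤ L, ∃ x z, ω ∈ RadialChain.crossTB (v i) s s x z) → (∀ i < L, ∀ k k', (k = i ∧ k' = i + 1 ∨ k = i + 1 ∧ k' = i) → v k' = v k + ![(s : ℤ), 0] → ∃ x z, ω ∈ RadialChain.crossLR (v k)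 (2 * s) s x z) → (∀ i < L, ∀ k k', (k = i ∧ k' = i + 1 ∨ k = i + 1 ∧ k' = i) → v k' = v k + ![(0 : ℤ), s] → ∃ x z, ω ∈ RadialChain.crossTB (v k) s (2 * s) x z) → ∃ x₀ ∈ RadialChain.boxSet (v 0) s s, ∃ y ∈ RadialChain.boxSet (v L) s s, ω ∈ openConnIn (RadialChain.chainRegion v s L) x₀ y :=
  fun hω s v L h1 h2 h3 h4 h5 => RadialChain.exists_openConnIn_of_squareChain hω s v L h1 h2 h3 h4 h5

end Summit.CriticalPhenomena.SAWScalingLimit.Theorems.IsingBoundaryRatio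

end
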